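import Mathlib.Probability.Distributions.Uniform
import Literature.Computability.Complexity.CNF
import Literature.Computability.Complexity.PNPWave0
import HarnessLib

/-!
# The random `k`-CNF ensemble `F_k(n, m)` and Feige's refutation hypothesis

Trunk T-CPLX-CORE (Literature/Computability/Complexity); definition request `wi-03695`
(`randomKCNF`, route PneNP/Feige).

* `kClauses k n` — the `2^k · C(n, k)` clauses with `k` DISTINCT variables in `{0, …, n-1}` and
  arbitrary signs, written with variables in increasing order (a `Finset` of the tree's
  `Clause ℕ = List (ℕ × Bool)`).
* `randomKCNF k n m : PMF (CNF ℕ)` — `m` clauses drawn i.i.d. uniformly from `kClauses k n`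
  (uniform on `Fin m → kClauses k n`, then listed); junk: the point mass at the empty CNF when there
  is no `k`-clause (`n < k`). [Feige 2002, §1; Ben-Sasson–Wigderson 2001, §6;
  Allen–O'Donnell–Witmer 2015, §1]
* `randomKCNFAtDensity k Δ n = randomKCNF k n ⌈Δ n⌉` and its Boolean pushforward
  `randomKCNFEnsemble k Δ : ℕ → PMF (List Bool)` along `encodingCNF` (an "ensemble" indexed by `n`).
* `FeigeHypothesis Δ` — the DETERMINISTIC-algorithm, SATISFIABLE-SOUND (`ε = 0`, "strong") form
  of Feige's refutation hypothesis for random 3-SAT at density `Δ` (Feige 2002, §1, Hypothesis 1;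
  Alekhnovich 2003, §4.1): no polynomial-time predicate `f` on encoded CNFs is (i) sound
  (`f = true` only on UNSATISFIABLE formulas) and (ii) accepts at least half of `F_3(n, ⌈Δn⌉)` for
  all large `n`. `FeigeHypothesisEps Δ ε` — the `(1-ε)`-SOUND ("weak") form (Feige 2002, §1,
  Hypothesis 2): soundness against formulas with `val(φ) ≥ 1 - ε` (`CNF.maxSatFraction`).
  For `ε ≥ 0` the strong form implies the weak one (`feigeHypothesisEps_of_feigeHypothesis`).
* CONTENT LIVES ONLY AT LARGE `Δ`: for `Δ` below the 3-SAT satisfiability threshold a sound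
  refuter accepts with probability `< 1/2`, so `FeigeHypothesis Δ` is simply TRUE there — e.g.
  `feigeHypothesis_zero : FeigeHypothesis 0` is proved below. Feige states the hypotheses for
  `Δ` a sufficiently large constant; bridge facts (e.g. "`FeigeHypothesis Δ → P ≠ NP`", valid for
  `Δ` above the threshold, where almost all formulas are unsatisfiable and a `P = NP` refuter would
  accept them) must be stated for such `Δ`, never as `∃ Δ` / `∀ Δ`. The acceptance threshold `1/2`
  follows the request `wi-03695` (Feige: "most" formulas; Alekhnovich renders it as `1 - o(1)`).
  Deterministic refuters only (Feige allows randomized ones), which makes each hypothesis weaker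
  than its randomized original.

## Sources

* U. Feige, *Relations between average case complexity and approximation complexity*, STOC 2002,
  §1 (Hypothesis 1: satisfiable-sound refutation; Hypothesis 2: `(1-ε)`-satisfiable-sound).
* M. Alekhnovich, *More on average case vs approximation complexity*, FOCS 2003, §4.1.
* E. Ben-Sasson, A. Wigderson, *Short proofs are narrow*, J. ACM 48 (2001), §6 (random `k`-CNF).
* S. R. Allen, R. O'Donnell, D. Witmer, *How to refute a random CSP*, FOCS 2015 (arXiv:1505.04383),
  §1.
-/

noncomputable section

open Filter

namespace Literature.Computability.Complexity

/-! ### The clause space -/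

/-- The clause on the (sorted) variable set `S ⊆ Fin n` with sign pattern `ε` (indexed by the
position in the sorted list): the tree's `Clause ℕ = List (ℕ × Bool)`.
[Ben-Sasson–Wigderson 2001, §6] [folklore] -/
def clauseOf {n : ℕ} (S : Finset (Fin n)) (ε : ℕ → Bool) : Clause ℕ :=
  ((S.sort (· ≤ ·)).map fun v : Fin n => (v : ℕ)).zipIdx.map fun p => (p.1, ε p.2)

/-- The finite set of `k`-clauses over `n` variables: `k` distinct variables in `{0, …, n-1}` (in
increasing order) with arbitrary signs — `2^k · C(n,k)` clauses (as a `Finset`, the image of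
(variable set, sign pattern on `Fin k`)). [Feige 2002, §1; Ben-Sasson–Wigderson 2001, §6;
Allen–O'Donnell–Witmer 2015, §1] [cite: BenSassonWigderson2001, §6] -/
def kClauses (k n : ℕ) : Finset (Clause ℕ) :=
  (((Finset.univ : Finset (Fin n)).powersetCard k) ×ˢ (Finset.univ : Finset (Fin k → Bool))).image
    fun p => clauseOf p.1 fun i => if h : i < k then p.2 ⟨i, h⟩ else false

/-! ### The random ensemble -/

/-- **The random `k`-CNF distribution `F_k(n, m)`**: `m` clauses drawn independently and uniformly
from `kClauses k n` (uniform law on `Fin m → kClauses k n`, listed in order; repetitions of clauses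
allowed, as in the i.i.d. model). Junk: `PMF.pure []` if `kClauses k n = ∅` (i.e. `n < k`).
[Feige 2002, §1; Ben-Sasson–Wigderson 2001, §6; Allen–O'Donnell–Witmer 2015, §1] [cite: Feige2002, §1] -/
def randomKCNF (k n m : ℕ) : PMF (CNF ℕ) :=
  if h : (kClauses k n).Nonempty then
    haveI : Nonempty ↥(kClauses k n) := h.coe_sort
    (PMF.uniformOfFintype (Fin m → ↥(kClauses k n))).map fun c => List.ofFn fun i => (c i : Clause ℕ)
  else PMF.pure []

/-- The ensemble at clause density `Δ`: `F_k(n, ⌈Δ n⌉)`. [Feige 2002, §1 (`m = Δn`, `Δ` a large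
constant)] [cite: BenSassonWigderson2001, §6] -/
def randomKCNFAtDensity (k : ℕ) (Δ : ℝ) (n : ℕ) : PMF (CNF ℕ) :=
  randomKCNF k n ⌈Δ * n⌉₊

/-- The Boolean pushforward along the tree's `encodingCNF`: an ensemble of distributions on
`{0,1}*` indexed by `n` (the shape of `Literature.Computability.MetaComplexity.Ensemble`). [Feige 2002, §1] [folklore] -/
def randomKCNFEnsemble (k : ℕ) (Δ : ℝ) : ℕ → PMF (List Bool) :=
  fun n => (randomKCNFAtDensity k Δ n).map encodingCNF.encode

/-! ### Feige's hypothesis (deterministic form) -/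

/-- A refutation predicate is SOUND: it accepts (the encoding of) a CNF only if the CNF is
unsatisfiable. [Feige 2002, §1 (refutation algorithms never err on satisfiable inputs)] [folklore] -/
def IsSoundRefuter (f : List Bool → Bool) : Prop :=
  ∀ φ : CNF ℕ, f (encodingCNF.encode φ) = true → ¬ φ.Satisfiable

/-- A refutation predicate is `(1-ε)`-SOUND: it accepts (the encoding of) a CNF only if fewer than
a `(1-ε)`-fraction of its clauses can be simultaneously satisfied (`val(φ) < 1 - ε`,
`CNF.maxSatFraction`). [Feige 2002, §1 (Hypothesis 2: never accept a formula with `(1-ε)m`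
satisfiable clauses)] [folklore] -/
def IsEpsSoundRefuter (ε : ℚ) (f : List Bool → Bool) : Prop :=
  ∀ φ : CNF ℕ, f (encodingCNF.encode φ) = true → φ.maxSatFraction < 1 - ε

/-- **Feige's refutation hypothesis, strong (satisfiable-sound, `ε = 0`) deterministic form, at
density `Δ`.** There is NO polynomial-time predicate `f` (`Literature.Computability.Complexity.IsPolyTimePred`) which is a
sound refuter (accepts only UNSATISFIABLE formulas) and accepts a random 3-CNF `F_3(n, ⌈Δn⌉)`
with probability at least `1/2` for all sufficiently large `n`. Meaningful only for `Δ` large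
(above the satisfiability threshold); for small `Δ` it is provable (`feigeHypothesis_zero`).
[Feige 2002, §1, Hypothesis 1; Alekhnovich 2003, §4.1] [cite: Feige2002, §1 Hypothesis 1] -/
def FeigeHypothesis (Δ : ℝ) : Prop :=
  ¬ ∃ f : List Bool → Bool, Literature.Computability.Complexity.IsPolyTimePred f ∧ IsSoundRefuter f ∧
    ∀ᶠ n in atTop, (1 / 2 : ENNReal) ≤
      (randomKCNFAtDensity 3 Δ n).toOuterMeasure {φ | f (encodingCNF.encode φ) = true}

/-- **Feige's refutation hypothesis, weak (`(1-ε)`-sound) deterministic form, at density `Δ`.**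
There is NO polynomial-time predicate which is `(1-ε)`-sound and accepts `F_3(n, ⌈Δn⌉)` with
probability at least `1/2` for all sufficiently large `n`. (Feige: for every fixed `ε > 0` and `Δ`
a sufficiently large constant.) [Feige 2002, §1, Hypothesis 2; Alekhnovich 2003, §4.1] [cite: Feige2002, §1 Hypothesis 2] -/
def FeigeHypothesisEps (Δ : ℝ) (ε : ℚ) : Prop :=
  ¬ ∃ f : List Bool → Bool, Literature.Computability.Complexity.IsPolyTimePred f ∧ IsEpsSoundRefuter ε f ∧
    ∀ᶠ n in atTop, (1 / 2 : ENNReal) ≤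
      (randomKCNFAtDensity 3 Δ n).toOuterMeasure {φ | f (encodingCNF.encode φ) = true}

/-! ### API -/

/-- With no clauses drawn the formula is empty. [folklore] -/
theorem randomKCNF_zero_clauses (k n : ℕ) : randomKCNF k n 0 = PMF.pure [] := by
  unfold randomKCNF
  split_ifs with h
  · haveI : Nonempty ↥(kClauses k n) := h.coe_sort
    ext φ
    simp [PMF.map_apply, List.ofFn_zero]
  · rfl

/-- Every sampled formula consists of `k`-clauses over `n` variables (support description).
[Ben-Sasson–Wigderson 2001, §6] [folklore] -/
theorem forall_mem_of_mem_support_randomKCNF {k n m : ℕ} {φ : CNF ℕ}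
    (hφ : φ ∈ (randomKCNF k n m).support) : ∀ c ∈ φ, c ∈ kClauses k n := by
  unfold randomKCNF at hφ
  split_ifs at hφ with h
  · haveI : Nonempty ↥(kClauses k n) := h.coe_sort
    rw [PMF.support_map] at hφ
    obtain ⟨c, -, rfl⟩ := hφ
    intro cl hcl
    rw [List.mem_ofFn] at hcl
    obtain ⟨i, rfl⟩ := hcl
    exact (c i).2
  · rw [PMF.support_pure, Set.mem_singleton_iff] at hφ
    subst hφ
    simp

/-- A trivially sound refuter: the constant `false`. (So `IsSoundRefuter` alone is satisfiable and
the content of `FeigeHypothesis` is in clause (ii).) [folklore] -/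
theorem isSoundRefuter_const_false : IsSoundRefuter fun _ => false := fun _ h => by simp at h

/-- A `(1-ε)`-sound refuter with `ε ≥ 0` is sound (given the tree fact `val(φ) = 1 ↔ φ`
satisfiable, `CNF.maxSatFraction_eq_one_iff`). [Feige 2002, §1] [folklore] -/
theorem IsEpsSoundRefuter.isSoundRefuter (hval : CNF.maxSatFraction_eq_one_iff (ν := ℕ)) {ε : ℚ}
    (hε : 0 ≤ ε) {f : List Bool → Bool} (h : IsEpsSoundRefuter ε f) : IsSoundRefuter f := by
  intro φ hf hsat
  have h1 : φ.maxSatFraction = 1 := (hval φ).2 hsat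
  have := h φ hf
  rw [h1] at this
  linarith

/-- The strong (satisfiable-sound) form implies the weak (`(1-ε)`-sound) form, `ε ≥ 0`.
[Feige 2002, §1] [folklore] -/
theorem feigeHypothesisEps_of_feigeHypothesis (hval : CNF.maxSatFraction_eq_one_iff (ν := ℕ))
    {Δ : ℝ} {ε : ℚ} (hε : 0 ≤ ε) (h : FeigeHypothesis Δ) : FeigeHypothesisEps Δ ε :=
  fun ⟨f, hp, hs, hev⟩ => h ⟨f, hp, hs.isSoundRefuter hval hε, hev⟩

/-- At density `0` the formula is empty (satisfiable), a sound refuter never accepts, and the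
hypothesis holds outright — witness that the content of `FeigeHypothesis Δ` is in LARGE `Δ`.
[folklore] -/
theorem feigeHypothesis_zero : FeigeHypothesis 0 := by
  rintro ⟨f, -, hs, hev⟩
  obtain ⟨n, hn⟩ := hev.exists
  have hf : f (encodingCNF.encode ([] : CNF ℕ)) = false := by
    by_contra h
    exact hs [] (by simpa using h) CNF.satisfiable_nil
  rw [randomKCNFAtDensity, zero_mul, Nat.ceil_zero, randomKCNF_zero_clauses,
    PMF.toOuterMeasure_pure_apply] at hn
  simp [hf] at hn

end Literature.Computability.Complexity
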